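import Summits.CriticalPhenomena.PercolationContinuityZ3.Theorems.SahiMasterFamilySparseEndUnionClosed

/-!
# The sparse end of Sahi's hierarchy, IV: cores, principal blocks, and `Λ(F) = N_{Qgood}(𝟙) ≥ 0`

Support file of the master-family programme (crux `NoHeavyLowerTail`, stmt-CriticalPhenomena-4575; cell `prim-masterthm`, seat P4,
unit `prim-masterthm-p4-g4`).  Seat document PROOF-SPARSE-END.md §2 (structure) + §3.  Pure finite combinatorics.

SETTING.  `β` a finite type of coordinates, `c : Finset β` a configuration (a minimum configuration of `⋂ U_i` in the application),
`F : Fin k → Finset (Finset β)` families of configurations, UP-CLOSED inside `2^c`, with `⋂_i F_i ∩ 2^c = {c}`.  For a block `R` of slots,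
`FR F c R = {a ⊆ c : a ∈ F_i ∀ i ∈ R}` and the CORE `core F c R = c ∩ ⋂_{a ∈ F_R} a`.

* `core_insert_subset`, `core_eq_biUnion` — cores are UNION-ADDITIVE: `core R = ⋃_{i∈R} core {i}` (nonempty `R`);
* `eq_core_of_admissible` — the SPLIT LEMMA: in an admissible block assignment (pairwise disjoint members `a_R ∈ F_R` covering `c`)
  every `a_R` is the core of `R`, and every block is GOOD (`F_R` principal, no core-overlap leaves `R`);
* `G_eq` — hence the number `G` of admissible assignments of a slot partition is `1` if all blocks are good and `0` otherwise;
* `goodBlocks_union`, `univ_mem_goodBlocks` — the good blocks form a union-closed family containing the full slot set;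
* **`Lambda_eq_N`, `Lambda_nonneg`**: `Λ(F) = Σ_{ρ partition of the slots} (−1)^{|ρ|+1} (∏_R (|R|−1)!) G(ρ)` equals `N_{goodBlocks}(𝟙)`
  and is `≥ 0` (`SahiSparseEnd.N_nonneg`).
What remains for the full sparse-end theorem on `E_k` (future work): the identification of `Λ(F)` with `lim_{p→0} p^{−m} E_k(μ_p;U)`
via the representative form.  HONEST FRAMING: elementary; [this work].
-/

namespace Summit.CriticalPhenomena.PercolationContinuityZ3.Theorems

namespace SahiSparseEnd

open Finset

variable {β : Type*} [DecidableEq β] {k : ℕ}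

/-! ### Block families and cores -/

/-- `F_R = {a ⊆ c : a ∈ F_i for all i ∈ R}`. [this work] -/
def FR (F : Fin k → Finset (Finset β)) (c : Finset β) (R : Finset (Fin k)) : Finset (Finset β) :=
  c.powerset.filter fun a => ∀ i ∈ R, a ∈ F i

/-- Membership in `F_R`. [this work] -/
theorem mem_FR {F : Fin k → Finset (Finset β)} {c : Finset β} {R : Finset (Fin k)} {a : Finset β} :
    a ∈ FR F c R ↔ a ⊆ c ∧ ∀ i ∈ R, a ∈ F i := by
  simp [FR]

/-- `F_R` is antitone in `R`. [this work] -/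
theorem FR_antitone {F : Fin k → Finset (Finset β)} {c : Finset β} {R R' : Finset (Fin k)} (h : R ⊆ R') :
    FR F c R' ⊆ FR F c R :=
  fun _ ha => mem_FR.2 ⟨(mem_FR.1 ha).1, fun i hi => (mem_FR.1 ha).2 i (h hi)⟩

/-- The core inside `c`: `κ(R) = c ∩ ⋂_{a ∈ F_R} a`. [this work] -/
def core (F : Fin k → Finset (Finset β)) (c : Finset β) (R : Finset (Fin k)) : Finset β :=
  c.filter fun x => ∀ a ∈ FR F c R, x ∈ a

/-- Membership in the core. [this work] -/
theorem mem_core {F : Fin k → Finset (Finset β)} {c : Finset β} {R : Finset (Fin k)} {x : β} :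
    x ∈ core F c R ↔ x ∈ c ∧ ∀ a ∈ FR F c R, x ∈ a := by
  simp [core]

/-- The core lies inside every member. [this work] -/
theorem core_subset_of_mem {F : Fin k → Finset (Finset β)} {c : Finset β} {R : Finset (Fin k)} {a : Finset β}
    (ha : a ∈ FR F c R) : core F c R ⊆ a := fun _ hx => (mem_core.1 hx).2 a ha

/-- The core lies inside `c`. [this work] -/
theorem core_subset {F : Fin k → Finset (Finset β)} {c : Finset β} {R : Finset (Fin k)} : core F c R ⊆ c :=
  fun _ hx => (mem_core.1 hx).1

/-- The core is monotone in `R`. [this work] -/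
theorem core_mono {F : Fin k → Finset (Finset β)} {c : Finset β} {R R' : Finset (Fin k)} (h : R ⊆ R') :
    core F c R ⊆ core F c R' :=
  fun _ hx => mem_core.2 ⟨(mem_core.1 hx).1, fun a ha => (mem_core.1 hx).2 a (FR_antitone h ha)⟩

section Structure

variable {F : Fin k → Finset (Finset β)} {c : Finset β}
  (hup : ∀ i a a', a ∈ F i → a ⊆ a' → a' ⊆ c → a' ∈ F i)
  (hcap : ∀ a : Finset β, a ⊆ c → ((∀ i, a ∈ F i) ↔ a = c))

include hup in
/-- `F_R` is up-closed inside `2^c`. [this work] -/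
theorem FR_up {R : Finset (Fin k)} {a a' : Finset β} (ha : a ∈ FR F c R) (h : a ⊆ a') (h' : a' ⊆ c) : a' ∈ FR F c R :=
  mem_FR.2 ⟨h', fun i hi => hup i a a' ((mem_FR.1 ha).2 i hi) h h'⟩

include hup in
/-- **Core additivity, one step**: `κ(R ∪ {j}) ⊆ κ(R) ∪ κ({j})`. [this work] -/
theorem core_insert_subset (R : Finset (Fin k)) (j : Fin k) : core F c (insert j R) ⊆ core F c R ∪ core F c {j} := by
  intro x hx
  rw [mem_union]
  by_contra h
  push Not at h
  obtain ⟨hxR, hxj⟩ := h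
  have hxc := (mem_core.1 hx).1
  have hxR' : ∃ a ∈ FR F c R, x ∉ a := by
    by_contra h'; push Not at h'; exact hxR (mem_core.2 ⟨hxc, h'⟩)
  have hxj' : ∃ b ∈ FR F c {j}, x ∉ b := by
    by_contra h'; push Not at h'; exact hxj (mem_core.2 ⟨hxc, h'⟩)
  obtain ⟨a, ha, hxa⟩ := hxR'
  obtain ⟨b, hb, hxb⟩ := hxj'
  have hac := (mem_FR.1 ha).1
  have hbc := (mem_FR.1 hb).1
  have hab : a ∪ b ∈ FR F c (insert j R) := by
    refine mem_FR.2 ⟨union_subset hac hbc, fun i hi => ?_⟩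
    rcases mem_insert.1 hi with rfl | hi
    · exact hup _ b _ ((mem_FR.1 hb).2 _ (mem_singleton_self _)) subset_union_right (union_subset hac hbc)
    · exact hup _ a _ ((mem_FR.1 ha).2 _ hi) subset_union_left (union_subset hac hbc)
  rcases mem_union.1 ((mem_core.1 hx).2 _ hab) with h | h
  · exact hxa h
  · exact hxb h

include hup in
/-- **Core additivity**: `κ(R) = ⋃_{i∈R} κ({i})` for nonempty `R`. [this work] -/
theorem core_eq_biUnion (R : Finset (Fin k)) (hR : R.Nonempty) : core F c R = R.biUnion fun i => core F c {i} := by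
  refine subset_antisymm ?_ (biUnion_subset.2 fun i hi => core_mono (singleton_subset_iff.2 hi))
  induction R using Finset.induction_on with
  | empty => exact absurd hR (by simp)
  | insert j R hj ih =>
    rcases R.eq_empty_or_nonempty with rfl | hRne
    · simp
    · rw [biUnion_insert]
      intro x hx
      rcases mem_union.1 (core_insert_subset hup R j hx) with h | h
      · exact mem_union_right _ (ih hRne h)
      · exact mem_union_left _ h

include hcap in
/-- `F_{univ} = {c}`. [this work] -/
theorem FR_univ : FR F c univ = {c} := by
  ext a
  rw [mem_FR, mem_singleton]
  constructor
  · rintro ⟨hac, h⟩; exact (hcap a hac).1 fun i => h i (mem_univ i)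
  · intro h
    rw [h]
    exact ⟨subset_rfl, fun i _ => ((hcap _ subset_rfl).2 rfl) i⟩

include hcap in
/-- `κ(univ) = c`. [this work] -/
theorem core_univ : core F c (univ : Finset (Fin k)) = c := by
  ext x
  rw [mem_core, FR_univ hcap]
  simp only [mem_singleton, forall_eq]
  tauto

/-! ### Good blocks and admissible assignments -/

/-- Good blocks: nonempty, `F_R` principal (`κ(R) ∈ F_R`), and no core-overlap leaves `R`. [this work] -/
def goodBlocks (F : Fin k → Finset (Finset β)) (c : Finset β) : Finset (Finset (Fin k)) :=
  univ.filter fun R => R.Nonempty ∧ core F c R ∈ FR F c R ∧ ∀ i ∈ R, ∀ j, j ∉ R → Disjoint (core F c {i}) (core F c {j})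

/-- Membership in `goodBlocks`. [this work] -/
theorem mem_goodBlocks {F : Fin k → Finset (Finset β)} {c : Finset β} {R : Finset (Fin k)} : R ∈ goodBlocks F c ↔
    R.Nonempty ∧ core F c R ∈ FR F c R ∧ ∀ i ∈ R, ∀ j, j ∉ R → Disjoint (core F c {i}) (core F c {j}) := by
  simp [goodBlocks]

/-- Admissible assignments of a slot partition `ρ`: `a_R ∈ F_R`, pairwise disjoint, covering `c`. [this work] -/
def admissible (F : Fin k → Finset (Finset β)) (c : Finset β) (ρ : Finset (Finset (Fin k))) :
    Finset ((R : Finset (Fin k)) → R ∈ ρ → Finset β) :=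
  (ρ.pi fun R => FR F c R).filter fun f =>
    (∀ R (hR : R ∈ ρ) R' (hR' : R' ∈ ρ), R ≠ R' → Disjoint (f R hR) (f R' hR')) ∧ ∀ x ∈ c, ∃ R, ∃ hR : R ∈ ρ, x ∈ f R hR

/-- `G(ρ)` = the number of admissible assignments. [this work] -/
def G (F : Fin k → Finset (Finset β)) (c : Finset β) (ρ : Finset (Finset (Fin k))) : ℕ := (admissible F c ρ).card

include hup hcap in
/-- **The split lemma**: in an admissible assignment of a slot partition every block receives its core, and every block is good.
[this work] -/
theorem eq_core_of_admissible {ρ : Finset (Finset (Fin k))} (hρ : ρ ∈ parts (univ : Finset (Fin k)))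
    {f : (R : Finset (Fin k)) → R ∈ ρ → Finset β} (hf : f ∈ admissible F c ρ) :
    (∀ R (hR : R ∈ ρ), f R hR = core F c R) ∧ ρ ⊆ goodBlocks F c := by
  rw [admissible, mem_filter, mem_pi] at hf
  obtain ⟨hfF, hdis, hcov⟩ := hf
  have hparts := mem_parts.1 hρ
  have hfc : ∀ R (hR : R ∈ ρ), f R hR ⊆ c := fun R hR => (mem_FR.1 (hfF R hR)).1
  -- the complement inside `c` of a block's set is covered by the other blocks, hence lies in `F_i` for every `i ∉ R`
  have hcompl : ∀ R (hR : R ∈ ρ), ∀ i, i ∉ R → c \ f R hR ∈ F i := by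
    intro R hR i hi
    obtain ⟨R', hR', hiR'⟩ := hparts.2.2 i (mem_univ i)
    have hne : R' ≠ R := fun e => hi (e ▸ hiR')
    refine hup i (f R' hR') _ ((mem_FR.1 (hfF R' hR')).2 i hiR') (fun x hx => mem_sdiff.2 ⟨hfc R' hR' hx, fun hx' => ?_⟩)
      sdiff_subset
    exact disjoint_left.1 (hdis R' hR' R hR hne) hx hx'
  -- key: every block's set is its core
  have hcore : ∀ R (hR : R ∈ ρ), f R hR = core F c R := by
    intro R hR
    refine subset_antisymm (fun x hx => mem_core.2 ⟨hfc R hR hx, fun a' ha' => ?_⟩) (core_subset_of_mem (hfF R hR))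
    -- `a' ∪ (c \ f R) = c`, so `a' ⊇ f R`
    have ha'c := (mem_FR.1 ha').1
    have hall : ∀ i, a' ∪ (c \ f R hR) ∈ F i := by
      intro i
      by_cases hi : i ∈ R
      · exact hup i a' _ ((mem_FR.1 ha').2 i hi) subset_union_left (union_subset ha'c sdiff_subset)
      · exact hup i _ _ (hcompl R hR i hi) subset_union_right (union_subset ha'c sdiff_subset)
    have huniv := (hcap _ (union_subset ha'c sdiff_subset)).1 hall
    have hxu : x ∈ a' ∪ (c \ f R hR) := by rw [huniv]; exact hfc R hR hx
    rcases mem_union.1 hxu with h | h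
    · exact h
    · exact absurd hx (mem_sdiff.1 h).2
  refine ⟨hcore, fun R hR => mem_goodBlocks.2 ⟨(hparts.1 R hR).1, ?_, fun i hi j hj => ?_⟩⟩
  · rw [← hcore R hR]; exact hfF R hR
  · obtain ⟨R', hR', hjR'⟩ := hparts.2.2 j (mem_univ j)
    have hne : R ≠ R' := fun e => hj (e ▸ hjR')
    have h1 : core F c {i} ⊆ f R hR := (core_mono (singleton_subset_iff.2 hi)).trans (hcore R hR).symm.subset
    have h2 : core F c {j} ⊆ f R' hR' := (core_mono (singleton_subset_iff.2 hjR')).trans (hcore R' hR').symm.subset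
    exact (hdis R hR R' hR' hne).mono h1 h2

include hup hcap in
/-- Conversely, if all blocks are good and there is at least one slot, the core assignment is admissible. [this work] -/
theorem core_admissible (hk : 0 < k) {ρ : Finset (Finset (Fin k))} (hρ : ρ ∈ parts (univ : Finset (Fin k)))
    (hgood : ρ ⊆ goodBlocks F c) : (fun R _ => core F c R) ∈ admissible F c ρ := by
  have hparts := mem_parts.1 hρ
  rw [admissible, mem_filter, mem_pi]
  refine ⟨fun R hR => (mem_goodBlocks.1 (hgood hR)).2.1, fun R hR R' hR' hne => ?_, fun x hx => ?_⟩
  · show Disjoint (core F c R) (core F c R')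
    rw [core_eq_biUnion hup R (hparts.1 R hR).1, core_eq_biUnion hup R' (hparts.1 R' hR').1, disjoint_biUnion_left]
    intro i hi
    rw [disjoint_biUnion_right]
    intro j hj
    have hjR : j ∉ R := fun h => disjoint_left.1 (hparts.2.1 R hR R' hR' hne) h hj
    exact (mem_goodBlocks.1 (hgood hR)).2.2 i hi j hjR
  · have hxu : x ∈ core F c (univ : Finset (Fin k)) := by rw [core_univ hcap]; exact hx
    rw [core_eq_biUnion hup univ ⟨⟨0, hk⟩, mem_univ _⟩, mem_biUnion] at hxu
    obtain ⟨i, -, hxi⟩ := hxu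
    obtain ⟨R, hR, hiR⟩ := hparts.2.2 i (mem_univ i)
    exact ⟨R, hR, core_mono (singleton_subset_iff.2 hiR) hxi⟩

include hup hcap in
/-- **`G(ρ) ∈ {0,1}`**: `G(ρ) = 1` if every block of `ρ` is good, `0` otherwise (`k ≥ 1`). [this work] -/
theorem G_eq (hk : 0 < k) {ρ : Finset (Finset (Fin k))} (hρ : ρ ∈ parts (univ : Finset (Fin k))) :
    G F c ρ = if ρ ⊆ goodBlocks F c then 1 else 0 := by
  unfold G
  split_ifs with hgood
  · rw [card_eq_one]
    refine ⟨fun R _ => core F c R, ?_⟩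
    ext f
    rw [mem_singleton]
    constructor
    · intro hf
      funext R hR
      exact (eq_core_of_admissible hup hcap hρ hf).1 R hR
    · rintro rfl
      exact core_admissible hup hcap hk hρ hgood
  · rw [card_eq_zero]
    exact eq_empty_of_forall_notMem fun f hf => hgood (eq_core_of_admissible hup hcap hρ hf).2

include hup in
/-- The good blocks are closed under unions. [this work] -/
theorem goodBlocks_union {R R' : Finset (Fin k)} (hR : R ∈ goodBlocks F c) (hR' : R' ∈ goodBlocks F c) :
    R ∪ R' ∈ goodBlocks F c := by
  rw [mem_goodBlocks] at hR hR' ⊢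
  obtain ⟨hRne, hRp, hRc⟩ := hR
  obtain ⟨hR'ne, hR'p, hR'c⟩ := hR'
  have hadd : core F c (R ∪ R') = core F c R ∪ core F c R' := by
    refine subset_antisymm ?_ (union_subset (core_mono subset_union_left) (core_mono subset_union_right))
    rw [core_eq_biUnion hup _ (hRne.mono subset_union_left), core_eq_biUnion hup _ hRne, core_eq_biUnion hup _ hR'ne,
      union_biUnion]
  refine ⟨hRne.mono subset_union_left, ?_, fun i hi j hj => ?_⟩
  · rw [hadd, mem_FR]
    refine ⟨union_subset core_subset core_subset, fun i hi => ?_⟩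
    rcases mem_union.1 hi with hi | hi
    · exact hup i _ _ ((mem_FR.1 hRp).2 i hi) subset_union_left (union_subset core_subset core_subset)
    · exact hup i _ _ ((mem_FR.1 hR'p).2 i hi) subset_union_right (union_subset core_subset core_subset)
  · rw [mem_union, not_or] at hj
    rcases mem_union.1 hi with hi | hi
    · exact hRc i hi j hj.1
    · exact hR'c i hi j hj.2

include hcap in
/-- The full slot set is a good block (`k ≥ 1`). [this work] -/
theorem univ_mem_goodBlocks (hk : 0 < k) : (univ : Finset (Fin k)) ∈ goodBlocks F c := by
  rw [mem_goodBlocks, core_univ hcap, FR_univ hcap]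
  exact ⟨⟨⟨0, hk⟩, mem_univ _⟩, mem_singleton_self _, fun i _ j hj => absurd (mem_univ j) hj⟩

/-! ### The leading sparse coefficient -/

/-- `Λ(F) = Σ_{ρ partition of the slots} (−1)^{|ρ|+1} (∏_{R∈ρ} (|R|−1)!) · G(ρ)`. [this work] -/
def Lambda (F : Fin k → Finset (Finset β)) (c : Finset β) : ℤ :=
  ∑ ρ ∈ parts (univ : Finset (Fin k)), (-1) ^ (ρ.card + 1) * (∏ R ∈ ρ, (((R.card - 1).factorial : ℕ) : ℤ)) * (G F c ρ : ℤ)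

include hup hcap in
/-- **`Λ(F) = N_{goodBlocks}(𝟙)`** (`k ≥ 1`). [this work] -/
theorem Lambda_eq_N (hk : 0 < k) : Lambda F c = N (goodBlocks F c) (fun _ => 1) (univ : Finset (Fin k)) := by
  rw [Lambda, N, sum_filter]
  refine sum_congr rfl fun ρ hρ => ?_
  rw [G_eq hup hcap hk hρ]
  split_ifs with h
  · rw [Nat.cast_one, mul_one]
    congr 1
    refine prod_congr rfl fun R _ => ?_
    rw [bw, sum_const, smul_eq_mul, mul_one]
  · simp

include hup hcap in
/-- **The leading sparse coefficient is nonnegative**: `Λ(F) ≥ 0` for families up-closed inside `2^c` with `⋂ F_i ∩ 2^c = {c}`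
(`k ≥ 1`). [this work] -/
theorem Lambda_nonneg (hk : 0 < k) : 0 ≤ Lambda F c := by
  rw [Lambda_eq_N hup hcap hk]
  exact N_nonneg ⟨⟨0, hk⟩, mem_univ _⟩ (fun R _ => mem_powerset.2 (subset_univ R))
    (fun A hA B hB => goodBlocks_union hup hA hB) (univ_mem_goodBlocks hcap hk) fun _ => le_rfl

end Structure

end SahiSparseEnd

end Summit.CriticalPhenomena.PercolationContinuityZ3.Theorems
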